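import Summits.ValiantsHypothesis.ValiantsHypothesis.Theorems.LacunarySymmetroidMatrixDescartesCensusTropicalKLawSlopes

/-!
# Route «KPlusLogSqLaw», crux `TropicalB` (stmt-ValiantsHypothesis-19771) — the `m = 2` tropical row, sharp ceiling:
# `T(2, K) ≤ 4K − 7` for every `K ≥ 3`

HONEST FRAMING.  Helper file for the registered stubs of crux `TropicalB` (cell `pub-symmetroid`, seat val-sym-trop-p4 (g2), 2026-08-26).
A SMALL-FORMAT row (size `m = 2`, every `K`) far inside the crux's known regime — nothing on `TropicalB` in its window,
`WeakLifting`, `MatrixDescartes` (stmt-ValiantsHypothesis-18050) or VP ≠ VNP.  It turns the cell's paper ceiling «`T_gen(2,K) ≤ 4K − 7`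
for every `K ≥ 3`» (HOME/DATA-CUT-0823.md l.556 (b)/(e), theory seat, «referee check welcome»; records `= 4K − 7` enumerated for `K ≤ 7`)
into a kernel theorem, sharpening the tree's thin-law row `TropicalCensus.tropRootLawAt_two : TropRootLawAt 2 K (4K − 3)`:

* `tropRootLawAt_two_sharp : 3 ≤ K → TropRootLawAt 2 K (4 * K - 7)`.

PROOF (the thin law's injection, minus four values).  Along a sign-alternating dominant chain the map `k ↦ (σₖ, termRank d (p k))`
is injective into `Perm(Fin 2) × [0, 2K−2]` (same permutation ⇒ column classes rise, `TropicalCensus.d_lt_of_dominant`; this is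
`tropRootLawAt_thin`).  The new remark: the exponent rank `dRank` is injective on exponent VALUES (`d_eq_of_dRank_eq`), so a term
whose total rank is one of the four extreme values `0, 1, 2K−3, 2K−2` has a determined multiset of column ranks
(`{0,0}, {0,1}, {K−2,K−1}, {K−1,K−1}`), hence a determined slope; slopes strictly increase along the chain
(`TropicalCensus.slope_lt_of_dominant`), so each extreme rank value is taken by at most ONE chain term instead of two (one per
permutation).  Hence `n + 1 ≤ 2(2K−1) − 4 = 4K − 6`.
[folklore] counting; the statement is the cell's (no citation exists).
-/

set_option linter.dupNamespace false
set_option autoImplicit false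

namespace Summit.ValiantsHypothesis.ValiantsHypothesis.Theorems.KPlusLogSqLaw

open Summit.ValiantsHypothesis.ValiantsHypothesis.Theorems.MatrixDescartes.Negative
open Summit.ValiantsHypothesis.ValiantsHypothesis.Theorems.LacunarySymmetroidMatrixDescartes
open Summit.ValiantsHypothesis.ValiantsHypothesis.Theorems.LacunarySymmetroidMatrixDescartes.TropicalCensus
open Finset

variable {K : ℕ}

/-- The exponent rank is injective on exponent values: equal ranks force equal exponents. [folklore] -/
theorem d_eq_of_dRank_eq (d : Fin K → ℕ) {l l' : Fin K} (h : dRank d l = dRank d l') : d l = d l' := by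
  rcases lt_trichotomy (d l) (d l') with hlt | heq | hgt
  · exact absurd h (ne_of_lt (dRank_lt_of_lt d hlt))
  · exact heq
  · exact absurd h.symm (ne_of_lt (dRank_lt_of_lt d hgt))

/-- total rank of a `2 × 2` term = the two column ranks. -/
theorem termRank_two (d : Fin K → ℕ) (q : Equiv.Perm (Fin 2) × (Fin 2 → Fin K)) :
    termRank d q = dRank d (q.2 0) + dRank d (q.2 1) := by
  unfold termRank; rw [Fin.sum_univ_two]

/-- slope of a `2 × 2` term = the two column exponents. -/
theorem slope_two (d : Fin K → ℕ) (q : Equiv.Perm (Fin 2) × (Fin 2 → Fin K)) :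
    TropicalCensus.slope d q = (d (q.2 0) : ℤ) + d (q.2 1) := by
  unfold TropicalCensus.slope; rw [Fin.sum_univ_two]

/-- **Extreme total ranks determine the slope** (`m = 2`, `K ≥ 3`): if two terms have the same total rank
`r ∈ {0, 1, 2K−3, 2K−2}`, then they have the same slope. -/
theorem slope_eq_of_termRank_extreme (hK : 3 ≤ K) (d : Fin K → ℕ) (q q' : Equiv.Perm (Fin 2) × (Fin 2 → Fin K))
    (hr : termRank d q = termRank d q')
    (hx : termRank d q = 0 ∨ termRank d q = 1 ∨ termRank d q = 2 * K - 3 ∨ termRank d q = 2 * K - 2) :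
    TropicalCensus.slope d q = TropicalCensus.slope d q' := by
  rw [termRank_two, termRank_two] at hr
  rw [termRank_two] at hx
  have h0 := dRank_le d (q.2 0)
  have h1 := dRank_le d (q.2 1)
  have h0' := dRank_le d (q'.2 0)
  have h1' := dRank_le d (q'.2 1)
  -- the multiset of column ranks is determined
  have hcases : (dRank d (q.2 0) = dRank d (q'.2 0) ∧ dRank d (q.2 1) = dRank d (q'.2 1)) ∨
      (dRank d (q.2 0) = dRank d (q'.2 1) ∧ dRank d (q.2 1) = dRank d (q'.2 0)) := by omega
  rw [slope_two, slope_two]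
  rcases hcases with ⟨ha, hb⟩ | ⟨ha, hb⟩
  · rw [d_eq_of_dRank_eq d ha, d_eq_of_dRank_eq d hb]
  · rw [d_eq_of_dRank_eq d ha, d_eq_of_dRank_eq d hb, add_comm]

/-- **Sharp `m = 2` tropical row**: `T(2, K) ≤ 4K − 7` for every `K ≥ 3` — every `2 × 2` dominance design with `K` classes has at most
`4K − 7` sign-alternating dominant breakpoints (the cell's enumerated records reach `4K − 7` for `3 ≤ K ≤ 7`). [cell statement; folklore proof] -/
theorem tropRootLawAt_two_sharp (K : ℕ) (hK : 3 ≤ K) : TropRootLawAt 2 K (4 * K - 7) := by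
  intro d v ε n θ p hε hθ hdom halt
  have hinj : Function.Injective p := stub_dominantInjective 2 K d v ε n θ p hθ hdom halt
  -- (1) same permutation ⇒ total rank strictly increases (as in `tropRootLawAt_thin`)
  have hkey : ∀ a b : Fin (n + 1), a < b → (p a).1 = (p b).1 → termRank d (p a) < termRank d (p b) := by
    intro a b hab h1
    have hne : p a ≠ p b := fun h => (ne_of_lt hab) (hinj h)
    have h2 : (p a).2 ≠ (p b).2 := fun h => hne (Prod.ext h1 h)
    obtain ⟨i, hi⟩ := Function.ne_iff.mp h2
    have hpa : p a = ((p a).1, (p a).2) := rfl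
    have hpb : p b = ((p a).1, (p b).2) := by rw [h1]
    have hda : IsDominant d v ε (θ a) ((p a).1, (p a).2) := hpa ▸ hdom a
    have hdb : IsDominant d v ε (θ b) ((p a).1, (p b).2) := hpb ▸ hdom b
    have hmono : ∀ j, dRank d ((p a).2 j) ≤ dRank d ((p b).2 j) := by
      intro j
      by_cases hj : (p a).2 j = (p b).2 j
      · rw [hj]
      · exact (dRank_lt_of_lt d (d_lt_of_dominant d v ε (hθ hab) _ _ _ hda hdb j hj)).le
    have hstrict : dRank d ((p a).2 i) < dRank d ((p b).2 i) :=
      dRank_lt_of_lt d (d_lt_of_dominant d v ε (hθ hab) _ _ _ hda hdb i hi)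
    unfold termRank
    exact sum_lt_sum (fun j _ => hmono j) ⟨i, mem_univ _, hstrict⟩
  have hsame : ∀ a b : Fin (n + 1), (p a).1 = (p b).1 → termRank d (p a) = termRank d (p b) → a = b := by
    intro a b h1 h2
    rcases lt_trichotomy a b with h | h | h
    · exact absurd h2 (ne_of_lt (hkey a b h h1))
    · exact h
    · exact absurd h2.symm (ne_of_lt (hkey b a h h1.symm))
  -- (2) slopes strictly increase ⇒ an extreme total rank is taken at most once
  have hslope : ∀ a b : Fin (n + 1), a < b → TropicalCensus.slope d (p a) < TropicalCensus.slope d (p b) := by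
    intro a b hab
    exact slope_lt_of_dominant d v ε (hθ hab) (fun h => (ne_of_lt hab) (hinj h)) (hdom a) (hdom b)
  have hext : ∀ a b : Fin (n + 1), termRank d (p a) = termRank d (p b) →
      (termRank d (p a) = 0 ∨ termRank d (p a) = 1 ∨ termRank d (p a) = 2 * K - 3 ∨ termRank d (p a) = 2 * K - 2) →
      a = b := by
    intro a b hr hx
    have hs := slope_eq_of_termRank_extreme hK d (p a) (p b) hr hx
    rcases lt_trichotomy a b with h | h | h
    · exact absurd hs (ne_of_lt (hslope a b h))
    · exact h
    · exact absurd hs.symm (ne_of_lt (hslope b a h))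
  -- (3) an explicit injective numbering of the chain by `[0, 4K − 6)`: rank `r ∈ {0, 1}` ↦ `r`; non-extreme rank
  --     `2 ≤ r ≤ 2K − 4` ↦ `2r − 2 + [σ = swap]`; `r = 2K − 3 ↦ 4K − 8`; `r = 2K − 2 ↦ 4K − 7`.
  have hrank : ∀ k, termRank d (p k) ≤ 2 * K - 2 := by
    intro k
    have := termRank_le d (p k)
    omega
  have hperm2 : ∀ σ τ : Equiv.Perm (Fin 2), σ ≠ 1 → τ ≠ 1 → σ = τ := by decide
  classical
  let sw : Fin (n + 1) → ℕ := fun k => if (p k).1 = 1 then 0 else 1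
  have hsw : ∀ k, sw k ≤ 1 := by intro k; simp only [sw]; split_ifs <;> omega
  have hsw' : ∀ a b, sw a = sw b → (p a).1 = (p b).1 := by
    intro a b h
    simp only [sw] at h
    split_ifs at h with ha hb hb
    · rw [ha, hb]
    · exact hperm2 _ _ ha hb
  let code : Fin (n + 1) → ℕ := fun k =>
    if termRank d (p k) ≤ 1 then termRank d (p k)
    else if 2 * K - 3 ≤ termRank d (p k) then termRank d (p k) + (2 * K - 5)
    else 2 * termRank d (p k) - 2 + sw k
  have hcode_lt : ∀ k, code k < 4 * K - 6 := by
    intro k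
    have h1 := hrank k; have h2 := hsw k
    simp only [code]
    split_ifs <;> omega
  have hcode : ∀ a b, code a = code b → termRank d (p a) = termRank d (p b) ∧
      (termRank d (p a) ≤ 1 ∨ 2 * K - 3 ≤ termRank d (p a) ∨ sw a = sw b) := by
    intro a b h
    have h1 := hrank a; have h2 := hrank b; have h3 := hsw a; have h4 := hsw b
    simp only [code] at h
    split_ifs at h <;> omega
  let f : Fin (n + 1) → Fin (4 * K - 6) := fun k => ⟨code k, hcode_lt k⟩
  have hf : Function.Injective f := by
    intro a b hab
    have h : code a = code b := by
      have := congrArg Fin.val hab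
      simpa [f] using this
    obtain ⟨hr, hx⟩ := hcode a b h
    have h1 := hrank a
    rcases hx with hx | hx | hx
    · exact hext a b hr (by omega)
    · exact hext a b hr (by omega)
    · exact hsame a b (hsw' a b hx) hr
  have hcard := Fintype.card_le_of_injective f hf
  simp only [Fintype.card_fin] at hcard
  omega

end Summit.ValiantsHypothesis.ValiantsHypothesis.Theorems.KPlusLogSqLaw
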